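import Mathlib
import HarnessLib

/-!
# T⁴ programme, node NE3 — census R26′, step 2b-α: THE REAL-VARIABLE BOOKKEEPING OF THE ℓ² REMAINDER TOWER (a discrete Grönwall along Bałaban's levels)

Cell `pub-balaban-gaps` (YM blitz, track G2, seat `ne3`, unit `pub-balaban-gaps-ne3`; writer prover-pub-balaban-gaps-ne3-g4-0, 2026-08-23), census
`run/shared/lean/pub/pub-balaban-gaps/ne/NE3.md` §4 R26′ ∕ §10 F8.  The ℓ² tower (finding F8) has three analytic inputs — the ℓ² contraction of the composed LINEAR parts
`‖Lin_m Y‖₂ ≤ 2ρ^m‖Y‖₂` (`ρ = L^{1−d∕2}`; the tree's `l2sq_QbarIter_le_class`), the sup tower `sup‖A_i‖ ≤ 2L^i b` ([B7] Prop. 4), the one-step remainder in ℓ²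
`‖C_i‖₂ ≤ K·sup‖A_i‖·‖A_i‖₂` (`RemainderSumsStepB8`, p353438) — and one algebraic input, the telescoping `Lin_k B − A_k = −Σ_{i<k} Lin_{k−i−1} C_i` (`RemainderTelescopeB8`).
What turns them into the k-FREE bound `‖Lin_k B − A_k‖₂ ≤ 32K·(ρL)^{k−1}·b·‖B‖₂` is pure real-variable bookkeeping: a strong induction `‖A_i‖₂ ≤ 4ρ^i‖B‖₂` under the k-free
smallness `8K·L^k·b ≤ ρ`, and a geometric sum.  THIS FILE proves exactly that bookkeeping for ABSTRACT non-negative sequences, so that step 2b-β only has to plug the four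
named inputs.

CONTENT (all [folklore]; 0 sorry; 0 def): `geom_sum_L_le` (`Σ_{i<k} L^i ≤ 2L^{k−1}` for `L ≥ 2`, `k ≥ 1`), **`tower_l2_induction`** (the strong induction), **`tower_l2_total`**
(the final bound).

HONEST FRAMING.  Elementary real analysis; nothing about Bałaban's objects is asserted; **NE3 is NOT proved**; spine PROVED 0∕9; finite T⁴ rung (B)+1 — NOT continuum YM on ℝ⁴,
NOT infinite volume, NOT mass gap, NOT `BetaPertH`, NOT Clay.  PLACEMENT: `Summits/QuantumFields/BalabanUV/T4Continuum/Spine/NE3/`.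
-/

set_option autoImplicit false

open scoped BigOperators
open Finset

namespace Summit.QuantumFields.BalabanUV.T4Continuum.NE3.RemainderTowerArith

/-- `Σ_{i<k} L^i ≤ 2·L^{k−1}` for `L ≥ 2` (all `k`; at `k = 0` both sides read `0 ≤ 2·L⁰∕…` trivially since the sum is empty). [folklore] -/
theorem geom_sum_L_le {L : ℝ} (hL : 2 ≤ L) : ∀ k : ℕ, ∑ i ∈ range k, L ^ i ≤ 2 * L ^ (k - 1)
  | 0 => by simp
  | k + 1 => by
      rw [Finset.sum_range_succ, Nat.add_sub_cancel]
      have ih := geom_sum_L_le hL k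
      have hL0 : 0 ≤ L := by linarith
      rcases k with _ | k
      · simp
      · rw [Nat.add_sub_cancel] at ih
        have : L ^ (k + 1) = L * L ^ k := by ring
        nlinarith [pow_nonneg hL0 k]

/-- **THE STRONG INDUCTION OF THE ℓ² TOWER**: non-negative sequences `a` (think `‖A_i‖₂`) and `c` (think `‖C_i‖₂`) with
`a i ≤ 2ρ^i·β + Σ_{i′<i} 2ρ^{i−1−i′}·c i′` and `c i ≤ K·(2L^i b)·a i` for `i ≤ k` (so `c ≥ 0` is not even needed), under the k-free smallness `16·K·L^k·b ≤ ρ` (`0 < ρ`, `2 ≤ L`), satisfy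
`a i ≤ 4ρ^i·β` for every `i ≤ k`. [folklore] -/
theorem tower_l2_induction {k : ℕ} {ρ L b β K : ℝ} (hρ : 0 < ρ) (hL : 2 ≤ L) (hb : 0 ≤ b) (hβ : 0 ≤ β) (hK : 0 ≤ K)
    (hsmall : 16 * K * L ^ k * b ≤ ρ) {a c : ℕ → ℝ}
    (ha : ∀ i ≤ k, a i ≤ 2 * ρ ^ i * β + ∑ i' ∈ range i, 2 * ρ ^ (i - 1 - i') * c i')
    (hc : ∀ i ≤ k, c i ≤ K * (2 * L ^ i * b) * a i) :
    ∀ i ≤ k, a i ≤ 4 * ρ ^ i * β := by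
  have hL1 : 1 ≤ L := by linarith
  have hL0 : 0 ≤ L := by linarith
  intro i
  induction i using Nat.strong_induction_on with
  | _ i ih =>
    intro hik
    have hsum : ∑ i' ∈ range i, 2 * ρ ^ (i - 1 - i') * c i' ≤ 2 * ρ ^ i * β := by
      rcases Nat.eq_zero_or_pos i with h0 | hpos
      · subst h0
        simp only [range_zero, sum_empty, pow_zero, mul_one]
        positivity
      have hterm : ∀ i' ∈ range i, 2 * ρ ^ (i - 1 - i') * c i' ≤ 16 * K * b * β * ρ ^ (i - 1) * L ^ i' := by
        intro i' hi'
        have hi'i : i' < i := mem_range.mp hi'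
        have h1 := hc i' (by omega)
        have h2 := ih i' hi'i (by omega)
        have h3 : c i' ≤ K * (2 * L ^ i' * b) * (4 * ρ ^ i' * β) :=
          h1.trans (mul_le_mul_of_nonneg_left h2 (by positivity))
        have h4 : 2 * ρ ^ (i - 1 - i') * c i' ≤ 2 * ρ ^ (i - 1 - i') * (K * (2 * L ^ i' * b) * (4 * ρ ^ i' * β)) :=
          mul_le_mul_of_nonneg_left h3 (by positivity)
        have e : ρ ^ (i - 1 - i') * ρ ^ i' = ρ ^ (i - 1) := by rw [← pow_add]; congr 1; omega
        calc 2 * ρ ^ (i - 1 - i') * c i' ≤ 2 * ρ ^ (i - 1 - i') * (K * (2 * L ^ i' * b) * (4 * ρ ^ i' * β)) := h4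
          _ = 16 * K * b * β * (ρ ^ (i - 1 - i') * ρ ^ i') * L ^ i' := by ring
          _ = 16 * K * b * β * ρ ^ (i - 1) * L ^ i' := by rw [e]
      have hgeo := geom_sum_L_le hL i
      have hLk : L ^ (i - 1) ≤ L ^ k := pow_le_pow_right₀ hL1 (by omega)
      have hρi : ρ ^ (i - 1) * ρ = ρ ^ i := by
        rw [← pow_succ]; congr 1; omega
      have hpre : 0 ≤ 16 * K * b * β * ρ ^ (i - 1) := by positivity
      calc ∑ i' ∈ range i, 2 * ρ ^ (i - 1 - i') * c i'
          ≤ ∑ i' ∈ range i, 16 * K * b * β * ρ ^ (i - 1) * L ^ i' := sum_le_sum hterm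
        _ = 16 * K * b * β * ρ ^ (i - 1) * ∑ i' ∈ range i, L ^ i' := by rw [mul_sum]
        _ ≤ 16 * K * b * β * ρ ^ (i - 1) * (2 * L ^ (i - 1)) := mul_le_mul_of_nonneg_left hgeo hpre
        _ ≤ 16 * K * b * β * ρ ^ (i - 1) * (2 * L ^ k) := mul_le_mul_of_nonneg_left (by linarith) hpre
        _ = 2 * β * ρ ^ (i - 1) * (16 * K * L ^ k * b) := by ring
        _ ≤ 2 * β * ρ ^ (i - 1) * ρ := mul_le_mul_of_nonneg_left hsmall (by positivity)
        _ = 2 * ρ ^ i * β := by rw [mul_assoc, hρi]; ring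
    calc a i ≤ 2 * ρ ^ i * β + ∑ i' ∈ range i, 2 * ρ ^ (i - 1 - i') * c i' := ha i hik
      _ ≤ 2 * ρ ^ i * β + 2 * ρ ^ i * β := by linarith
      _ = 4 * ρ ^ i * β := by ring

/-- **THE TOTAL OF THE ℓ² TOWER**: under the hypotheses of `tower_l2_induction`, any `E ≤ Σ_{i<k} 2ρ^{k−1−i}·c i` (think
`‖Lin_k B − A_k‖₂`) obeys `E ≤ 32·K·β·b·(ρL)^{k−1}` — at `ρL = 1` (Bałaban's `d = 4`: `ρ = L^{1−d∕2}`) a k-FREE multiple of `b·β` (`= sup‖B‖·‖B‖₂`). [folklore] -/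
theorem tower_l2_total {k : ℕ} {ρ L b β K E : ℝ} (hρ : 0 < ρ) (hL : 2 ≤ L) (hb : 0 ≤ b) (hβ : 0 ≤ β) (hK : 0 ≤ K)
    (hsmall : 16 * K * L ^ k * b ≤ ρ) {a c : ℕ → ℝ}
    (ha : ∀ i ≤ k, a i ≤ 2 * ρ ^ i * β + ∑ i' ∈ range i, 2 * ρ ^ (i - 1 - i') * c i')
    (hc : ∀ i ≤ k, c i ≤ K * (2 * L ^ i * b) * a i)
    (hE : E ≤ ∑ i ∈ range k, 2 * ρ ^ (k - 1 - i) * c i) :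
    E ≤ 32 * K * β * b * (ρ * L) ^ (k - 1) := by
  have hL0 : 0 ≤ L := by linarith
  have hA := tower_l2_induction hρ hL hb hβ hK hsmall ha hc
  have hterm : ∀ i ∈ range k, 2 * ρ ^ (k - 1 - i) * c i ≤ 16 * K * b * β * ρ ^ (k - 1) * L ^ i := by
    intro i hi
    have hik : i < k := mem_range.mp hi
    have h3 : c i ≤ K * (2 * L ^ i * b) * (4 * ρ ^ i * β) :=
      (hc i hik.le).trans (mul_le_mul_of_nonneg_left (hA i hik.le) (by positivity))
    have e : ρ ^ (k - 1 - i) * ρ ^ i = ρ ^ (k - 1) := by rw [← pow_add]; congr 1; omega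
    calc 2 * ρ ^ (k - 1 - i) * c i ≤ 2 * ρ ^ (k - 1 - i) * (K * (2 * L ^ i * b) * (4 * ρ ^ i * β)) :=
          mul_le_mul_of_nonneg_left h3 (by positivity)
      _ = 16 * K * b * β * (ρ ^ (k - 1 - i) * ρ ^ i) * L ^ i := by ring
      _ = 16 * K * b * β * ρ ^ (k - 1) * L ^ i := by rw [e]
  have hpre : 0 ≤ 16 * K * b * β * ρ ^ (k - 1) := by positivity
  calc E ≤ ∑ i ∈ range k, 2 * ρ ^ (k - 1 - i) * c i := hE
    _ ≤ ∑ i ∈ range k, 16 * K * b * β * ρ ^ (k - 1) * L ^ i := sum_le_sum hterm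
    _ = 16 * K * b * β * ρ ^ (k - 1) * ∑ i ∈ range k, L ^ i := by rw [mul_sum]
    _ ≤ 16 * K * b * β * ρ ^ (k - 1) * (2 * L ^ (k - 1)) := mul_le_mul_of_nonneg_left (geom_sum_L_le hL k) hpre
    _ = 32 * K * β * b * (ρ * L) ^ (k - 1) := by rw [mul_pow]; ring

end Summit.QuantumFields.BalabanUV.T4Continuum.NE3.RemainderTowerArith
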